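import Summits.BirchSwinnertonDyer.BirchSwinnertonDyer.Theorems.ManinLocalTwoThreeNewformPinningFiftySix
import Summits.BirchSwinnertonDyer.BirchSwinnertonDyer.Theorems.ManinLocalTwoThreeCurveExclusionFortyFour
import HarnessLib

/-!
# Level 54 = 2·3³ (C3 domain, `9 ∣ 54`, genus 4): THE NEWFORM OF EVERY `X₀(54)`-DATUM IS `54a` OR `54b`, pinned by the curve's own
# recursion — planner-an g51's turnkey T-an-g51-54, def-free

Cell bsd-f2-manin, route `ManinLocalTwoThree`, crux C3 `ManinPrimeToThreeAtNine` (stmt-22968: `3² ∣ 54`), prover seat p2 gen 29;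
`--supports` (helper).  AUTHOR of the mathematics and of the Lean bodies: planner seat -an gen 51 (`HOME/an/g51/Sketch-an-g51-L54.lean`
`94b8f4b31ed156dc`, farm rc 0); this file lands it DEF-FREE (the four `η`-quotient cusp forms are an existence theorem, the generic
lemmas already in the tree are imported from `NewformPinningFiftySix` / `LevelFortyFour`), in the namespace `…LevelFiftyFour`.

THE RESULT.  `S₂(Γ₀(54))` (genus 4) is spanned by FOUR holomorphic `η`-quotients of level 54 (certified by `decide`):
`B₁ = η₃η₁₈²η₅₄²/η₂₇`, `B₂ = η₃η₁₈³η₂₇²/(η₉η₅₄)`, `B₃ = η₆η₉³η₅₄²/(η₁₈η₂₇)`, `B₄ = η₆η₉²η₂₇²/η₅₄` (orders at `∞`: 5, 2, 4, 1).  For every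
`X₀(54)`-datum `D` of an elliptic `W/ℚ` and ANY four cusp forms `g₁..g₄` carrying the pivot table of `B₁..B₄` at `n ∈ {1,2,4,5,8,10}`:
`D.f = 2g₁ − g₂ + g₃ + g₄` (`54a`) or `D.f = −2g₁ + g₂ + g₃ + g₄` (`54b`) — `f_eq_of_table_fiftyFour`.  The 24 table entries are
discharged in the sequel by the an-g53 `η`-coefficient certificates (`BracketSturm.qExpansion_coeff_eq_of_etaCertificate_cuspForm`).
THE MECHANISM (MEMO-an §96.1): on the space `a₁, a₂, a₄, a₅` are coordinates and `a₈ = −a₅ − 2a₂`, `a₁₀ = −a₄ − 2a₁`; on the curve `2 ∣ 54`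
gives `2 ∣ N_W` (fact-free from the datum), so `a₄ = a₂²`, `a₈ = a₂³`, `a₁₀ = a₂a₅`, whence `(a₂² − 1)(a₂² + 2) = 0`: `a₂ = ±1`, `a₄ = 1`,
`a₅ = ∓3` — exactly `54a` / `54b`; the old line `27a(q) + t·27a(q²)` has `a₄ = −2 ≠ a₂²` and never arises.  NO newness of any explicit
form, NO Hecke computation on the space, NO Sturm, NO Hasse bound, NO old-subspace exclusion.  Nothing here proves C3, Manin's conjecture
or BSD. [cite: DiamondShurman2005, §8.8 (8.44), Thm. 3.5.1, §3.8] [cite: CremonaAlgorithms1997, Table 3 (N = 54)] [cite: Ligozat1975, Prop. 3.2.1]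
-/

set_option autoImplicit false
-- lint-debt: the directory name repeats the summit name (sibling precedent `ManinLocalTwoThreeNewformPinningFiftySix.lean`)
set_option linter.dupNamespace false

noncomputable section

open Complex Filter Topology Set Function
open UpperHalfPlane hiding I
open scoped Real Topology MatrixGroups ModularForm
open ModularForm CongruenceSubgroup
open Literature.NumberTheory.ModularForms
open Literature.NumberTheory.EllipticCurves Literature.NumberTheory.EllipticCurves.ModularForms

namespace Summit.BirchSwinnertonDyer.BirchSwinnertonDyer.Theorems.ManinLocalTwoThree.LevelFiftyFour

open NewformPinningFiftySix (dvd_conductorNorm_iff)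
open LevelFortyFour (lFunction_four lFunction_eight lFunction_mul)

/-! ## §1 Coefficients of a four-term combination -/

/-- `aₙ` of a four-term combination. [folklore] -/
theorem cuspCoeff_comb₄ {N : ℕ} {k : ℤ} (x₁ x₂ x₃ x₄ : ℂ) (g₁ g₂ g₃ g₄ : CuspForm (Gamma0 N) k) (n : ℕ) :
    cuspCoeff (x₁ • g₁ + x₂ • g₂ + x₃ • g₃ + x₄ • g₄) n =
      x₁ * cuspCoeff g₁ n + x₂ * cuspCoeff g₂ n + x₃ * cuspCoeff g₃ n + x₄ * cuspCoeff g₄ n := by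
  simp only [cuspCoeff_add_form (one_mem_strictPeriods_coe_gamma0 N), cuspCoeff_smul]

/-! ## §2 The curve side at level 54: `a₄ = 1`, `(a₂, a₅) ∈ {(−1, 3), (1, −3)}` — integers only, no Hasse bound -/

section CurveSide

variable (W : WeierstrassCurve ℚ) [W.IsElliptic]

omit [W.IsElliptic] in
/-- **The curve side of the level-54 pinning (integers only; no Hasse bound, no old-subspace exclusion).**  With
`2 ∣ N_W` (fact-free from the datum, §1) and the two basis-free relations of `S₂(Γ₀(54))` at `n = 8, 10`:
`a₄ = 1` and `(a₂, a₅) ∈ {(−1, 3), (1, −3)}`. [cite: DiamondShurman2005, §8.8 (8.44)] -/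
theorem curveSide_fiftyFour [W.IsElliptic] (h2N : 2 ∣ W.conductorNorm ℤ)
    (h8 : W.LFunction 8 = -W.LFunction 5 - 2 * W.LFunction 2)
    (h10 : W.LFunction 10 = -W.LFunction 4 - 2) :
    W.LFunction 4 = 1 ∧
      ((W.LFunction 2 = -1 ∧ W.LFunction 5 = 3) ∨ (W.LFunction 2 = 1 ∧ W.LFunction 5 = -3)) := by
  have hrec4 := lFunction_four W
  rw [if_pos h2N, sub_zero] at hrec4
  have hrec8 := lFunction_eight W
  rw [if_pos h2N, sub_zero] at hrec8
  have hm10 : W.LFunction 10 = W.LFunction 2 * W.LFunction 5 := lFunction_mul W (show Nat.Coprime 2 5 by norm_num)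
  have e1 : W.LFunction 2 * W.LFunction 4 = -W.LFunction 5 - 2 * W.LFunction 2 := by rw [← hrec8, h8]
  have e2 : W.LFunction 2 * W.LFunction 5 = -W.LFunction 4 - 2 := by rw [← hm10, h10]
  generalize W.LFunction 2 = s at hrec4 e1 e2 ⊢
  generalize W.LFunction 5 = r at e1 e2 ⊢
  generalize W.LFunction 4 = u at hrec4 e1 e2 ⊢
  subst hrec4
  have hr : r = -(s * (s * s)) - 2 * s := by linarith
  subst hr
  have hpoly : (s * s - 1) * (s * s + 2) = 0 := by linear_combination (-1 : ℤ) * e2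
  rcases mul_eq_zero.mp hpoly with h1 | h2
  · have hfac : (s - 1) * (s + 1) = 0 := by linear_combination h1
    rcases mul_eq_zero.mp hfac with hs | hs
    · have hs1 : s = 1 := by linarith
      subst hs1; norm_num
    · have hs1 : s = -1 := by linarith
      subst hs1; norm_num
  · nlinarith [mul_self_nonneg s]

/-- **Coordinates at 54.**  If `(x₁, x₂, x₃, x₄)` are the coordinates of a form with `aₙ = aₙ(W)` on `(B₁, B₂, B₃, B₄)`
(column equations at `n = 1,2,4,5,8,10` from the certified table) and `2 ∣ N_W`, then the vector is `(2,−1,1,1)` (54a)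
or `(−2,1,1,1)` (54b). [cite: DiamondShurman2005, §8.8 (8.44)] [cite: CremonaAlgorithms1997, Table 3 (N = 54)] -/
theorem coeffVector_fiftyFour (h2N : 2 ∣ W.conductorNorm ℤ) (x₁ x₂ x₃ x₄ : ℂ)
    (k1 : x₄ = (W.LFunction 1 : ℂ))
    (k2 : x₂ = (W.LFunction 2 : ℂ))
    (k4 : x₃ = (W.LFunction 4 : ℂ))
    (k5 : x₁ - x₂ = (W.LFunction 5 : ℂ))
    (k8 : -x₁ - x₂ = (W.LFunction 8 : ℂ))
    (k10 : -x₃ - 2 * x₄ = (W.LFunction 10 : ℂ)) :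
    (x₁ = 2 ∧ x₂ = -1 ∧ x₃ = 1 ∧ x₄ = 1) ∨ (x₁ = -2 ∧ x₂ = 1 ∧ x₃ = 1 ∧ x₄ = 1) := by
  rw [WeierstrassCurve.LFunction_apply_one, Int.cast_one] at k1
  -- the two basis-free relations, transported to the integers `aₙ(W)`
  have hz8 : W.LFunction 8 = -W.LFunction 5 - 2 * W.LFunction 2 := by
    have : ((W.LFunction 8 : ℤ) : ℂ) = ((-W.LFunction 5 - 2 * W.LFunction 2 : ℤ) : ℂ) := by
      push_cast; linear_combination -k8 - k5 - 2 * k2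
    exact_mod_cast this
  have hz10 : W.LFunction 10 = -W.LFunction 4 - 2 := by
    have : ((W.LFunction 10 : ℤ) : ℂ) = ((-W.LFunction 4 - 2 : ℤ) : ℂ) := by
      push_cast; linear_combination -k10 - k4 - 2 * k1
    exact_mod_cast this
  have ex₁ : x₁ = (W.LFunction 5 : ℂ) + (W.LFunction 2 : ℂ) := by linear_combination k5 + k2
  obtain ⟨h4, hcases⟩ := curveSide_fiftyFour W h2N hz8 hz10
  rcases hcases with ⟨h2, h5⟩ | ⟨h2, h5⟩
  · simp only [h2, h4, h5] at ex₁ k2 k4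
    push_cast at ex₁ k2 k4
    exact Or.inl ⟨by linear_combination ex₁, k2, k4, k1⟩
  · simp only [h2, h4, h5] at ex₁ k2 k4
    push_cast at ex₁ k2 k4
    exact Or.inr ⟨by linear_combination ex₁, k2, k4, k1⟩

end CurveSide

/-! ## §3 Level 54: the genus, the four `η`-quotient cusp forms, the span, and the pinning modulo the pivot table -/

/-- `μ(Γ₀(54)) = 108`, `ν_∞ = 12`, `ν₂ = ν₃ = 0`. [cite: DiamondShurman2005, §3.8] -/
theorem gamma0_data_54 : gamma0Index 54 = 108 ∧ nuInfty 54 = 12 ∧ nu₂ 54 = 0 ∧ nu₃ 54 = 0 := by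
  refine ⟨(gamma0Index_mul (m := 2) (n := 27) (by norm_num)).trans ?_, by decide, by rw [nu₂_eq_card]; decide,
    by rw [nu₃_eq_card]; decide⟩
  rw [show (2 : ℕ) = 2 ^ 1 by norm_num, gamma0Index_prime_pow (p := 2) (e := 1) Nat.prime_two (by norm_num),
    show (27 : ℕ) = 3 ^ 3 by norm_num, gamma0Index_prime_pow (p := 3) (e := 3) Nat.prime_three (by norm_num)]
  norm_num

/-- **`dim S₂(Γ₀(54)) = 4`.** [cite: DiamondShurman2005, Thm. 3.5.1] -/
theorem finrank_cuspForm_two_fiftyFour : Module.finrank ℂ (CuspForm (Gamma0 54) 2) = 4 := by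
  have h := finrank_cuspForm_two_eq_genusX0_holds 54
  unfold finrank_cuspForm_two_eq_genusX0 at h
  rw [h, Literature.NumberTheory.EllipticCurves.ModularForms.genusX0_fiftyFour]

/-- Certificate for `B₁` (Newman: `Σr = 4`, `Σδr = 120`, `Σ(54/δ)r = 24`, `3·18²·27·54² = 8748²`; Ligozat orders
`1,1,1,1,1,2,1,5 > 0` at the cusps `1/c`, `c ∣ 54`). [folklore] -/
theorem etaCert_B1 : EtaCert 54 [(3, 1), (18, 2), (27, -1), (54, 2)] 8748 := by
  decide

/-- Certificate for `B₂` (`3·9·18³·27²·54 = 78732²`; orders `1,1,1,1,1,2,4,2`). [folklore] -/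
theorem etaCert_B2 : EtaCert 54 [(3, 1), (9, -1), (18, 3), (27, 2), (54, -1)] 78732 := by
  decide

/-- Certificate for `B₃` (`6·9³·18·27·54² = 78732²`; orders `1,1,1,1,2,1,2,4`). [folklore] -/
theorem etaCert_B3 : EtaCert 54 [(6, 1), (9, 3), (18, -1), (27, -1), (54, 2)] 78732 := by
  decide

/-- Certificate for `B₄` (`6·9²·27²·54 = 4374²`; orders `1,1,1,1,2,1,5,1`). [folklore] -/
theorem etaCert_B4 : EtaCert 54 [(6, 1), (9, 2), (27, 2), (54, -1)] 4374 := by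
  decide

/-- **The four `η`-quotient cusp forms of level 54 exist in `S₂(Γ₀(54))`** (`etaQuotientCuspForm` on the certificates). [folklore] -/
theorem exists_etaCuspForms_fiftyFour : ∃ B₁ B₂ B₃ B₄ : CuspForm (Gamma0 54) 2,
    (B₁ : ℍ → ℂ) = etaQuotient 54 (expFn [(3, 1), (18, 2), (27, -1), (54, 2)]) ∧
    (B₂ : ℍ → ℂ) = etaQuotient 54 (expFn [(3, 1), (9, -1), (18, 3), (27, 2), (54, -1)]) ∧
    (B₃ : ℍ → ℂ) = etaQuotient 54 (expFn [(6, 1), (9, 3), (18, -1), (27, -1), (54, 2)]) ∧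
    (B₄ : ℍ → ℂ) = etaQuotient 54 (expFn [(6, 1), (9, 2), (27, 2), (54, -1)]) :=
  ⟨etaQuotientCuspForm 54 _ 2 (by decide) (newmanCond_of_etaCert etaCert_B1) etaCert_B1.2.2.2.2,
    etaQuotientCuspForm 54 _ 2 (by decide) (newmanCond_of_etaCert etaCert_B2) etaCert_B2.2.2.2.2,
    etaQuotientCuspForm 54 _ 2 (by decide) (newmanCond_of_etaCert etaCert_B3) etaCert_B3.2.2.2.2,
    etaQuotientCuspForm 54 _ 2 (by decide) (newmanCond_of_etaCert etaCert_B4) etaCert_B4.2.2.2.2, rfl, rfl, rfl, rfl⟩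

/-- **Four forms with the unit-triangular pivot table at `n = 1,2,4,5` span `S₂(Γ₀(54))`.** [folklore] -/
theorem exists_coords_fiftyFour (g₁ g₂ g₃ g₄ : CuspForm (Gamma0 54) 2)
    (c₁ : cuspCoeff g₁ 1 = 0) (c₂ : cuspCoeff g₁ 2 = 0) (c₄ : cuspCoeff g₁ 4 = 0) (c₅ : cuspCoeff g₁ 5 = 1)
    (d₁ : cuspCoeff g₂ 1 = 0) (d₂ : cuspCoeff g₂ 2 = 1) (d₄ : cuspCoeff g₂ 4 = 0) (d₅ : cuspCoeff g₂ 5 = -1)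
    (e₁ : cuspCoeff g₃ 1 = 0) (e₂ : cuspCoeff g₃ 2 = 0) (e₄ : cuspCoeff g₃ 4 = 1) (e₅ : cuspCoeff g₃ 5 = 0)
    (p₁ : cuspCoeff g₄ 1 = 1) (p₂ : cuspCoeff g₄ 2 = 0) (p₄ : cuspCoeff g₄ 4 = 0) (p₅ : cuspCoeff g₄ 5 = 0)
    (f : CuspForm (Gamma0 54) 2) : ∃ x₁ x₂ x₃ x₄ : ℂ, f = x₁ • g₁ + x₂ • g₂ + x₃ • g₃ + x₄ • g₄ := by
  haveI : FiniteDimensional ℂ (CuspForm (Gamma0 54) 2) := finiteDimensional_cuspForm_gamma0 54 2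
  have hli : LinearIndependent ℂ ![g₁, g₂, g₃, g₄] := by
    rw [Fintype.linearIndependent_iff]
    intro c hc i
    rw [Fin.sum_univ_four] at hc
    simp only [Matrix.cons_val_zero, Matrix.cons_val_one, Matrix.cons_val] at hc
    have r1 := congrArg (cuspCoeff · 1) hc
    have r2 := congrArg (cuspCoeff · 2) hc
    have r4 := congrArg (cuspCoeff · 4) hc
    have r5 := congrArg (cuspCoeff · 5) hc
    simp only [cuspCoeff_comb₄, NewformPinningFiftySix.cuspCoeff_zero_form, c₁, c₂, c₄, c₅, d₁, d₂, d₄, d₅, e₁, e₂, e₄, e₅,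
      p₁, p₂, p₄, p₅] at r1 r2 r4 r5
    have hc3 : c 3 = 0 := by linear_combination r1
    have hc1 : c 1 = 0 := by linear_combination r2
    have hc2 : c 2 = 0 := by linear_combination r4
    have hc0 : c 0 = 0 := by linear_combination r5 + hc1
    fin_cases i <;> assumption
  have hspan := hli.span_eq_top_of_card_eq_finrank' (by rw [finrank_cuspForm_two_fiftyFour]; simp)
  have hf : f ∈ Submodule.span ℂ (Set.range ![g₁, g₂, g₃, g₄]) := by rw [hspan]; exact Submodule.mem_top
  obtain ⟨c, hc⟩ := Submodule.mem_span_range_iff_exists_fun ℂ |>.mp hf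
  refine ⟨c 0, c 1, c 2, c 3, ?_⟩
  rw [← hc, Fin.sum_univ_four]
  simp only [Matrix.cons_val_zero, Matrix.cons_val_one, Matrix.cons_val]

/-- **LEVEL-54 PINNING, ABSTRACT FORM.**  Any four forms `g₁..g₄` of `S₂(Γ₀(54))` carrying the certified coefficient table
at `n = 1,2,4,5,8,10` pin the newform of every `X₀(54)`-datum: `D.f = 2g₁ − g₂ + g₃ + g₄` or `D.f = −2g₁ + g₂ + g₃ + g₄`.
[cite: CremonaAlgorithms1997, Table 3 (N = 54)] -/
theorem f_eq_of_table_fiftyFour {W : WeierstrassCurve ℚ} [W.IsElliptic] (D : ModularParametrizationData W 54)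
    (g₁ g₂ g₃ g₄ : CuspForm (Gamma0 54) 2)
    (c₁ : cuspCoeff g₁ 1 = 0) (c₂ : cuspCoeff g₁ 2 = 0) (c₄ : cuspCoeff g₁ 4 = 0) (c₅ : cuspCoeff g₁ 5 = 1)
    (c₈ : cuspCoeff g₁ 8 = -1) (c₁₀ : cuspCoeff g₁ 10 = 0)
    (d₁ : cuspCoeff g₂ 1 = 0) (d₂ : cuspCoeff g₂ 2 = 1) (d₄ : cuspCoeff g₂ 4 = 0) (d₅ : cuspCoeff g₂ 5 = -1)
    (d₈ : cuspCoeff g₂ 8 = -1) (d₁₀ : cuspCoeff g₂ 10 = 0)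
    (e₁ : cuspCoeff g₃ 1 = 0) (e₂ : cuspCoeff g₃ 2 = 0) (e₄ : cuspCoeff g₃ 4 = 1) (e₅ : cuspCoeff g₃ 5 = 0)
    (e₈ : cuspCoeff g₃ 8 = 0) (e₁₀ : cuspCoeff g₃ 10 = -1)
    (p₁ : cuspCoeff g₄ 1 = 1) (p₂ : cuspCoeff g₄ 2 = 0) (p₄ : cuspCoeff g₄ 4 = 0) (p₅ : cuspCoeff g₄ 5 = 0)
    (p₈ : cuspCoeff g₄ 8 = 0) (p₁₀ : cuspCoeff g₄ 10 = -2) :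
    D.f = (2 : ℂ) • g₁ - g₂ + g₃ + g₄ ∨ D.f = (-2 : ℂ) • g₁ + g₂ + g₃ + g₄ := by
  obtain ⟨x₁, x₂, x₃, x₄, hf⟩ := exists_coords_fiftyFour g₁ g₂ g₃ g₄ c₁ c₂ c₄ c₅ d₁ d₂ d₄ d₅ e₁ e₂ e₄ e₅
    p₁ p₂ p₄ p₅ D.f
  have key : ∀ n, x₁ * cuspCoeff g₁ n + x₂ * cuspCoeff g₂ n + x₃ * cuspCoeff g₃ n + x₄ * cuspCoeff g₄ n =
      (W.LFunction n : ℂ) := fun n ↦ by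
    rw [← cuspCoeff_comb₄, ← hf]; exact D.isNewformOf.2 n
  have k1 := key 1; have k2 := key 2; have k4 := key 4; have k5 := key 5; have k8 := key 8; have k10 := key 10
  simp only [c₁, c₂, c₄, c₅, c₈, c₁₀, d₁, d₂, d₄, d₅, d₈, d₁₀, e₁, e₂, e₄, e₅, e₈, e₁₀, p₁, p₂, p₄, p₅, p₈, p₁₀,
    mul_zero, mul_one, add_zero, zero_add] at k1 k2 k4 k5 k8 k10
  -- the one curve-side input, fact-free from the datum
  have h2N : 2 ∣ W.conductorNorm ℤ := (dvd_conductorNorm_iff D Nat.prime_two).mpr ⟨27, by norm_num⟩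
  rcases coeffVector_fiftyFour W h2N x₁ x₂ x₃ x₄ (by linear_combination k1) (by linear_combination k2)
      (by linear_combination k4) (by linear_combination k5) (by linear_combination k8) (by linear_combination k10)
    with ⟨hx₁, hx₂, hx₃, hx₄⟩ | ⟨hx₁, hx₂, hx₃, hx₄⟩ <;>
    rw [hx₁, hx₂, hx₃, hx₄] at hf <;> simp only [one_smul, neg_one_smul] at hf
  · left; rw [hf]; abel
  · right; rw [hf]

end Summit.BirchSwinnertonDyer.BirchSwinnertonDyer.Theorems.ManinLocalTwoThree.LevelFiftyFour

end
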